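import Summits.QuantumFields.BalabanUV.T4Continuum.Support.VariationalVectorRegularity
import Summits.QuantumFields.BalabanUV.T4Continuum.Support.VariationalVectorOneStepPhys

/-!
# T⁴ programme, spine node NE2 (U1a), lane P2 — leaf V-REG (1-forms), file 3/4: THE `hREG k` BINDER OF THE VECTOR END
# (`VariationalVectorEndOfLeaves.towerLimitRate_effV_of_leaves`, p220074) FOR V-ONE-1F's REGULARITY FUNCTIONAL `ρV := rhoV` (p219670):
# `QvL T W = φ → (W minimises ScV n M R G on the fibre) → rhoV n M R W ≤ C_R·(ScV n M R G W + nsqV M φ)` — from file 2/4 (Euler–Lagrange by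
# multiplier-free UB-duality) and leaf-09-g6's VECTOR BOCHNER `sum_hessv_le_el` (p219745); `C_R` explicit; the Feynman–Landau inhabitant `G = landauG 1 R`
# discharges the gauge-form binder (REG-G) exactly (`t4/skeletons/NE2-t4-ne2-p2.md` §2.E row V-REG; cell `pub-balaban`, NE2 formalisation swarm,
# leaf prover 03 gen 5)

HONEST FRAMING (T4-DAG p. 1).  Rung (B)+1 only — NOT infinite volume, NOT a mass gap, NOT Clay.  NE2 is NOT IN PRINT and NOT proved here.  MODEL LEVEL,
`E = ℂ`: UNITARY bond transports `R` with operator plaquette defect `≤ p`, CONTRACTIVE line-indexed transports `T` of the (1.18) average, the gauge∕curvature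
matrix `Gm` (PSD, `G = qform Gm ∘ unc`) — all DATA (c5).  This file is WIRING ([folklore] arithmetic) of file 2/4 and leaf-09-g6's Bochner inequality in
the currency of the END; one data `def` (`defG`, the gauge-form gradient defect); no `def … : Prop`; no `sorry`; axioms standard.  HONEST DEPENDENCY (cell,
verbatim): continuum YM on T⁴ ⇐ BetaPertH ∧ nine spine estimates (0/9 proved); BetaPertH ⇐ (D1) ∧ (D4) ∧ CAP+tail; G-an2-4 gates asym, D1 and NE2/3/4.

THE STATEMENT.  DISPLAYED binders (the same currency as the END's other leaves, cf. the scalar `VariationalCovariantRegularityRho.hREG_rho` which displays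
UB⁺ and P⁺): V-UB `hUBc` (constant `Λ`), V-P `hPc` (`C_P`), the Gårding inequality (Går) `n^{−d}(n²·roughV R W) ≤ CGar·ScV W + CGar′·nsqV (QvL T W)`
(leaf-09-g6's `VariationalVectorGarding.garding_of_poincare` shape), and ONE new honest binder on the gauge form,
  (REG-G)  `(n⁴/n^d)·Σ_{x,ν} |(D div_R W)_ν(x) − (Gm·unc W)(x,ν)|² ≤ cG·ScV W + cG′·qWV W`
«the gradient of `G` is the gradient of the divergence, up to a form-bounded remainder» — which HOLDS WITH `cG = cG′ = 0` for the Feynman–Landau matrix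
`Gm = KLandau 1 R` (`defG_landau_one`), and is NOT expected uniformly in `n` for `landauG δ`, `δ ≠ 1` (the remainder `(1 − δ⁻¹)·D div W` is second order).
CONCLUSION (`hREG_rhoV`): with `α := n²·p`,
  `C_R = 8Λ + 8cG + 2dα·(CGar + CGar′) + (8cG′ + 5d²α²)·C_P`
— k-UNIFORM when the binders' constants are (plaquette class `n²p ≤ c`); and ON THE ROAD's PRODUCT-LINE TRANSPORTS `QvL (lineT T′ R)` (§4, `hREG_rhoV_landau_line`),
where leaf-01-g5's rough Poincaré `qWV_le_line_poincare` and leaf-09-g6's `garding_landau` ∕ `qWV_le_line_landau` discharge (Går) and V-P, the ONLY displayed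
leaf binder is V-UB and the constant collapses to **`C_R = 4Λ + ½`** in the classes `2d(nw)² ≤ ½`, `40d(n²p) ≤ 1`.  Route: `rhoV = (n⁴/n^d)·Σ_κ hessv(W_κ)` ≤ (Bochner) `4·(n⁴/n^d)Σ|½curl†curl W + D div W|² +
2d·α·n^{−d}(n²·roughV) + 5d²α²·(n⁴/n^d·n^{−4})…`, the first term split as `elOpV W + defG W` (file 2/4's `physEl_le_of_isMin` + (REG-G)), the second by (Går), the
masses by V-P.  No NE3, no propagator, no multiplier.
-/

noncomputable section

open scoped BigOperators ComplexConjugate ComplexOrder Matrix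

namespace Summit.QuantumFields.BalabanUV.T4Continuum.VariationalVectorRegularityRho

open Finset
open Literature.Analysis.Complex (qform)
open Literature.MathematicalPhysics.QuantumFieldTheory.Balaban1983to89.B5Prop11Plancherel (Tor fine unitVec)
open Literature.MathematicalPhysics.QuantumFieldTheory.Balaban1983to89.B5Blocks16 (blockOf)
open Summit.QuantumFields.BalabanUV.T4Continuum.VariationalColourFederbush (norm_le_one_of_mem_unitary)
open Summit.QuantumFields.BalabanUV.T4Continuum.VariationalVectorFederbush (lineT norm_lineT_le_one)
open Summit.QuantumFields.BalabanUV.T4Continuum.VariationalVectorPoincare (qWV_le_line_poincare)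
open Summit.QuantumFields.BalabanUV.T4Continuum.VariationalColourInterpolant (hessv)
open Summit.QuantumFields.BalabanUV.T4Continuum.VariationalVectorBochner (curlAdjCurlV gradDivV sum_hessv_le_el)
open Summit.QuantumFields.BalabanUV.T4Continuum.VectorBlockTrialForm (nsqV nsqV_nonneg QvL roughV roughV_nonneg)
open Summit.QuantumFields.BalabanUV.T4Continuum.VariationalVectorForm (ScV qWV ScV_nonneg qWV_nonneg norm_sub_sq_le_two)
open Summit.QuantumFields.BalabanUV.T4Continuum.VariationalVectorEffective (unc cur cur_unc unc_cur)
open Summit.QuantumFields.BalabanUV.T4Continuum.VariationalVectorLandauTower (Kdiv KLandau landauG_eq_qform KLandau_posSemidef)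
open Summit.QuantumFields.BalabanUV.T4Continuum.VariationalVectorGarding (landauG landauG_nonneg garding_landau qWV_le_line_landau)
open Summit.QuantumFields.BalabanUV.T4Continuum.VariationalVectorEndOfLeaves (nonneg_of_qform)
open Summit.QuantumFields.BalabanUV.T4Continuum.VariationalVectorOneStep (hessV)
open Summit.QuantumFields.BalabanUV.T4Continuum.VariationalVectorOneStepPhys (rhoV)
open Summit.QuantumFields.BalabanUV.T4Continuum.VariationalVectorRegularity (elOpV physEl_le_of_isMin physEl_le_of_isMin_div Kdiv_mulVec_unc)

variable {d : ℕ} (n : ℕ) [NeZero n] (M : Fin d → ℕ) [hM : ∀ μ, NeZero (M μ)]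

/-! ## §1 The gauge-form gradient defect and the lattice-unit Bochner bound at the Euler–Lagrange operator -/

/-- the GAUGE-FORM GRADIENT DEFECT `(defG W)_ν(x) := (D div_R W)_ν(x) − (Gm·unc W)(x,ν)` — zero when `Gm` is the divergence-form matrix `Kdiv R`. [folklore] -/
def defG (R : Tor (fine n M) → Fin d → (ℂ →L[ℂ] ℂ)) (Gm : Matrix (Tor (fine n M) × Fin d) (Tor (fine n M) × Fin d) ℂ)
    (W : Tor (fine n M) → Fin d → ℂ) : Tor (fine n M) → Fin d → ℂ :=
  fun x ν => gradDivV (fine n M) R W x ν - cur (Gm *ᵥ unc W) x ν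

/-- the Bochner operator splits as Euler–Lagrange operator plus gauge-form defect: `½curl†curl W + D div W = elOpV W + defG W`. [folklore] -/
theorem bochnerOp_eq (R : Tor (fine n M) → Fin d → (ℂ →L[ℂ] ℂ)) (Gm : Matrix (Tor (fine n M) × Fin d) (Tor (fine n M) × Fin d) ℂ)
    (W : Tor (fine n M) → Fin d → ℂ) (x : Tor (fine n M)) (ν : Fin d) :
    curlAdjCurlV (fine n M) R W x ν + gradDivV (fine n M) R W x ν = elOpV n M R Gm W x ν + defG n M R Gm W x ν := by
  unfold elOpV defG; ring

/-- `Σ_{x,ν}|½curl†curl W + D div W|² ≤ 2·nsqV (elOpV W) + 2·nsqV (defG W)`. [folklore] -/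
theorem nsq_bochnerOp_le (R : Tor (fine n M) → Fin d → (ℂ →L[ℂ] ℂ)) (Gm : Matrix (Tor (fine n M) × Fin d) (Tor (fine n M) × Fin d) ℂ)
    (W : Tor (fine n M) → Fin d → ℂ) :
    ∑ x, ∑ ν, ‖curlAdjCurlV (fine n M) R W x ν + gradDivV (fine n M) R W x ν‖ ^ 2
      ≤ 2 * nsqV (fine n M) (elOpV n M R Gm W) + 2 * nsqV (fine n M) (defG n M R Gm W) := by
  unfold nsqV
  rw [mul_sum, mul_sum, ← sum_add_distrib]
  refine sum_le_sum fun x _ => ?_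
  rw [mul_sum, mul_sum, ← sum_add_distrib]
  refine sum_le_sum fun ν _ => ?_
  rw [bochnerOp_eq]
  have h := norm_sub_sq_le_two (elOpV n M R Gm W x ν) (-(defG n M R Gm W x ν))
  rw [sub_neg_eq_add, norm_neg] at h
  exact h

/-- `rhoV`'s lattice functional IS the left side of leaf-09-g6's `sum_hessv_le_el`. [folklore] -/
theorem hessV_eq_sum (R : Tor (fine n M) → Fin d → (ℂ →L[ℂ] ℂ)) (W : Tor (fine n M) → Fin d → ℂ) :
    hessV (fine n M) R W = ∑ κ, hessv (fine n M) R (fun y => W y κ) := rfl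

/-- **LATTICE-UNIT BOCHNER AT THE EULER–LAGRANGE OPERATOR** (unitary `R`, plaquette defect `≤ p`, any `Gm`, EVERY `W`):
`hessV W ≤ 8·nsqV (elOpV W) + 8·nsqV (defG W) + 2pd·roughV W + 5p²d²·nsqV W`. [folklore] -/
theorem hessV_le {R : Tor (fine n M) → Fin d → (ℂ →L[ℂ] ℂ)} (hU : ∀ x μ, R x μ ∈ unitary (ℂ →L[ℂ] ℂ)) {p : ℝ} (hp : 0 ≤ p)
    (hP : ∀ x μ ν, ‖R x μ * R (x + unitVec (fine n M) μ) ν - R x ν * R (x + unitVec (fine n M) ν) μ‖ ≤ p)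
    (Gm : Matrix (Tor (fine n M) × Fin d) (Tor (fine n M) × Fin d) ℂ) (W : Tor (fine n M) → Fin d → ℂ) :
    hessV (fine n M) R W ≤ 8 * nsqV (fine n M) (elOpV n M R Gm W) + 8 * nsqV (fine n M) (defG n M R Gm W)
      + 2 * p * d * roughV n M R W + 5 * (p ^ 2 * d ^ 2) * nsqV (fine n M) W := by
  have h1 := sum_hessv_le_el n M hU hp hP W
  have h2 := nsq_bochnerOp_le n M R Gm W
  rw [hessV_eq_sum]
  linarith

/-! ## §2 Physical units: the `hREG k` binder of the vector END for `ρV := rhoV` -/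

/-- **LEAF V-REG (1-forms) — THE `hREG k` BINDER OF `towerLimitRate_effV_of_leaves` FOR `ρV := rhoV`, GENERAL GAUGE MATRIX `Gm`** (model level, `E = ℂ`).
DATA: unitary `R` with plaquette defect `≤ p`, contractive line transports `T`, `Gm` PSD with `G = qform Gm ∘ unc`.  DISPLAYED: V-UB `hUBc` (`Λ`), V-P `hPc` (`C_P`),
(Går) `hGar` (`CGar`, `CGar′`), (REG-G) `hRG` (`cG`, `cG′`).  CONCLUSION: for every datum `φ` and every minimiser `W` of `ScV n M R G` on `{QvL T · = φ}`,
`rhoV n M R W ≤ C_R·(ScV n M R G W + nsqV M φ)`, `C_R = 8Λ + 8cG + 2d(n²p)(CGar + CGar′) + (8cG′ + 5d²(n²p)²)·C_P`. [folklore] -/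
theorem hREG_rhoV {R : Tor (fine n M) → Fin d → (ℂ →L[ℂ] ℂ)} (hU : ∀ x μ, R x μ ∈ unitary (ℂ →L[ℂ] ℂ)) {p : ℝ} (hp : 0 ≤ p)
    (hP : ∀ x μ ν, ‖R x μ * R (x + unitVec (fine n M) μ) ν - R x ν * R (x + unitVec (fine n M) ν) μ‖ ≤ p)
    {Gm : Matrix (Tor (fine n M) × Fin d) (Tor (fine n M) × Fin d) ℂ} (hGm : Gm.PosSemidef)
    {G : (Tor (fine n M) → Fin d → ℂ) → ℝ} (hG : ∀ W, G W = qform Gm (unc W))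
    {T : Tor M → (Fin d → Fin n) → Fin n → Fin d → (ℂ →L[ℂ] ℂ)} (hT : ∀ y j t μ, ‖T y j t μ‖ ≤ 1)
    {Λ CP CGar CGar' cG cG' : ℝ} (hΛ : 0 ≤ Λ) (hCGar : 0 ≤ CGar) (hCGar' : 0 ≤ CGar') (hcG : 0 ≤ cG) (hcG' : 0 ≤ cG')
    -- leaf V-UB (the END's `hUBc k`) and leaf V-P (the END's `hPc k`)
    (hUBc : ∀ φ : Tor M → Fin d → ℂ, ∃ W, QvL n M T W = φ ∧ ScV n M R G W ≤ Λ * nsqV M φ)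
    (hPc : ∀ W, qWV n M W ≤ CP * (ScV n M R G W + nsqV M (QvL n M T W)))
    -- (Går): the Gårding inequality (leaf-09-g6's `garding_of_poincare` shape)
    (hGar : ∀ W, ((n : ℝ) ^ d)⁻¹ * ((n : ℝ) ^ 2 * roughV n M R W) ≤ CGar * ScV n M R G W + CGar' * nsqV M (QvL n M T W))
    -- (REG-G): the gauge form's gradient is the gradient of the divergence up to a form-bounded remainder
    (hRG : ∀ W, (n : ℝ) ^ 4 / (n : ℝ) ^ d * nsqV (fine n M) (defG n M R Gm W) ≤ cG * ScV n M R G W + cG' * qWV n M W) :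
    ∀ (φ : Tor M → Fin d → ℂ) (W : Tor (fine n M) → Fin d → ℂ), QvL n M T W = φ →
      (∀ W₂, QvL n M T W₂ = φ → ScV n M R G W ≤ ScV n M R G W₂) →
      rhoV n M R W ≤ (8 * Λ + 8 * cG + 2 * d * ((n : ℝ) ^ 2 * p) * (CGar + CGar') + (8 * cG' + 5 * (d : ℝ) ^ 2 * ((n : ℝ) ^ 2 * p) ^ 2) * CP)
        * (ScV n M R G W + nsqV M φ) := by
  intro φ W hW hmin
  have hn : (0 : ℝ) < (n : ℝ) := by exact_mod_cast Nat.pos_of_ne_zero (NeZero.ne n)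
  have hd : (0 : ℝ) ≤ d := Nat.cast_nonneg d
  have hsc : (0 : ℝ) ≤ (n : ℝ) ^ 4 / (n : ℝ) ^ d := by positivity
  have hG0 : ∀ W, 0 ≤ G W := nonneg_of_qform n M hGm hG
  set S : ℝ := ScV n M R G W with hS
  set Z : ℝ := nsqV M φ with hZ
  set q : ℝ := qWV n M W with hq
  set α : ℝ := (n : ℝ) ^ 2 * p with hα
  have hS0 : 0 ≤ S := ScV_nonneg n M R hG0 W
  have hZ0 : 0 ≤ Z := nsqV_nonneg M φ
  have hq0 : 0 ≤ q := qWV_nonneg n M W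
  have hα0 : 0 ≤ α := by positivity
  -- the four inputs in physical units
  have hEL : (n : ℝ) ^ 4 / (n : ℝ) ^ d * nsqV (fine n M) (elOpV n M R Gm W) ≤ Λ * S := physEl_le_of_isMin n M hGm hG hT hΛ hUBc hW hmin
  have hRG' : (n : ℝ) ^ 4 / (n : ℝ) ^ d * nsqV (fine n M) (defG n M R Gm W) ≤ cG * S + cG' * q := hRG W
  have hGar' : ((n : ℝ) ^ d)⁻¹ * ((n : ℝ) ^ 2 * roughV n M R W) ≤ CGar * S + CGar' * Z := by rw [hS, hZ, ← hW]; exact hGar W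
  have hP' : q ≤ CP * (S + Z) := by rw [hq, hS, hZ, ← hW]; exact hPc W
  -- Bochner in physical units
  have hB := hessV_le n M hU hp hP Gm W
  have hrho : rhoV n M R W = (n : ℝ) ^ 4 / (n : ℝ) ^ d * hessV (fine n M) R W := rfl
  have h1 : rhoV n M R W ≤ 8 * (Λ * S) + 8 * (cG * S + cG' * q) + 2 * d * α * (CGar * S + CGar' * Z) + 5 * (d : ℝ) ^ 2 * α ^ 2 * q := by
    have e : (n : ℝ) ^ 4 / (n : ℝ) ^ d * (8 * nsqV (fine n M) (elOpV n M R Gm W) + 8 * nsqV (fine n M) (defG n M R Gm W)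
        + 2 * p * d * roughV n M R W + 5 * (p ^ 2 * d ^ 2) * nsqV (fine n M) W)
        = 8 * ((n : ℝ) ^ 4 / (n : ℝ) ^ d * nsqV (fine n M) (elOpV n M R Gm W)) + 8 * ((n : ℝ) ^ 4 / (n : ℝ) ^ d * nsqV (fine n M) (defG n M R Gm W))
          + 2 * d * α * (((n : ℝ) ^ d)⁻¹ * ((n : ℝ) ^ 2 * roughV n M R W)) + 5 * (d : ℝ) ^ 2 * α ^ 2 * q := by
      rw [hα, hq]; unfold qWV; ring
    have hr0 : 0 ≤ ((n : ℝ) ^ d)⁻¹ * ((n : ℝ) ^ 2 * roughV n M R W) := by have := roughV_nonneg n M R W; positivity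
    calc rhoV n M R W ≤ (n : ℝ) ^ 4 / (n : ℝ) ^ d * (8 * nsqV (fine n M) (elOpV n M R Gm W) + 8 * nsqV (fine n M) (defG n M R Gm W)
          + 2 * p * d * roughV n M R W + 5 * (p ^ 2 * d ^ 2) * nsqV (fine n M) W) := by rw [hrho]; exact mul_le_mul_of_nonneg_left hB hsc
      _ = _ := e
      _ ≤ _ := by
          have h2dα : 0 ≤ 2 * d * α := by positivity
          nlinarith [mul_le_mul_of_nonneg_left hGar' h2dα, hEL, hRG']
  -- absorb the masses by V-P and collect
  have hq' : (8 * cG' + 5 * (d : ℝ) ^ 2 * α ^ 2) * q ≤ (8 * cG' + 5 * (d : ℝ) ^ 2 * α ^ 2) * (CP * (S + Z)) :=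
    mul_le_mul_of_nonneg_left hP' (by positivity)
  have key : 8 * (Λ * S) + 8 * (cG * S + cG' * q) + 2 * d * α * (CGar * S + CGar' * Z) + 5 * (d : ℝ) ^ 2 * α ^ 2 * q
      ≤ (8 * Λ + 8 * cG + 2 * d * α * (CGar + CGar') + (8 * cG' + 5 * (d : ℝ) ^ 2 * α ^ 2) * CP) * (S + Z) := by
    have e1 : 8 * (Λ * S) + 8 * (cG * S + cG' * q) + 2 * d * α * (CGar * S + CGar' * Z) + 5 * (d : ℝ) ^ 2 * α ^ 2 * q
        = (8 * Λ + 8 * cG + 2 * d * α * CGar) * S + 2 * d * α * CGar' * Z + (8 * cG' + 5 * (d : ℝ) ^ 2 * α ^ 2) * q := by ring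
    have e2 : (8 * Λ + 8 * cG + 2 * d * α * (CGar + CGar') + (8 * cG' + 5 * (d : ℝ) ^ 2 * α ^ 2) * CP) * (S + Z)
        = (8 * Λ + 8 * cG + 2 * d * α * CGar) * S + 2 * d * α * CGar' * Z + (8 * cG' + 5 * (d : ℝ) ^ 2 * α ^ 2) * (CP * (S + Z))
          + ((8 * Λ + 8 * cG + 2 * d * α * CGar) * Z + 2 * d * α * CGar' * S) := by ring
    rw [e1, e2]
    have p1 : 0 ≤ (8 * Λ + 8 * cG + 2 * d * α * CGar) * Z := by positivity
    have p2 : 0 ≤ 2 * d * α * CGar' * S := by positivity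
    linarith
  exact h1.trans key

/-! ## §3 The Feynman–Landau inhabitant `G = landauG 1 R`: (REG-G) holds with `cG = cG′ = 0` -/

/-- for the Feynman–Landau matrix `KLandau 1 R = 1⁻¹ • Kdiv R` the gauge-form gradient defect VANISHES: `D div W − (KLandau 1 R)·unc W = 0`. [folklore] -/
theorem defG_landau_one (R : Tor (fine n M) → Fin d → (ℂ →L[ℂ] ℂ)) (W : Tor (fine n M) → Fin d → ℂ) :
    defG n M R (KLandau (fine n M) 1 R) W = 0 := by
  funext x ν
  unfold defG KLandau
  rw [Matrix.smul_mulVec, Kdiv_mulVec_unc, inv_one, Complex.ofReal_one, one_smul, cur_unc]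
  exact sub_self _

/-- hence (REG-G) for the Feynman–Landau inhabitant with `cG = cG′ = 0`. [folklore] -/
theorem hRG_landau_one (R : Tor (fine n M) → Fin d → (ℂ →L[ℂ] ℂ)) (W : Tor (fine n M) → Fin d → ℂ) :
    (n : ℝ) ^ 4 / (n : ℝ) ^ d * nsqV (fine n M) (defG n M R (KLandau (fine n M) 1 R) W)
      ≤ 0 * ScV n M R (landauG (fine n M) 1 R) W + 0 * qWV n M W := by
  rw [defG_landau_one]
  unfold nsqV
  simp

/-- **LEAF V-REG FOR THE DIVERGENCE FORM `G = qform (Kdiv R) ∘ unc = divSq R`, DIRECT ROUTE** (no split of the Bochner operator: by `elOpV_Kdiv` it IS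
`½curl†curl + D div`, so file 2/4's `physEl_le_of_isMin_div` feeds `sum_hessv_le_el` as is): displayed V-UB (`Λ`), V-P (`C_P`), (Går) (`CGar`, `CGar′`);
`C_R = 4Λ + 2d(n²p)(CGar + CGar′) + 5d²(n²p)²·C_P`. [folklore] -/
theorem hREG_rhoV_div {R : Tor (fine n M) → Fin d → (ℂ →L[ℂ] ℂ)} (hU : ∀ x μ, R x μ ∈ unitary (ℂ →L[ℂ] ℂ)) {p : ℝ} (hp : 0 ≤ p)
    (hP : ∀ x μ ν, ‖R x μ * R (x + unitVec (fine n M) μ) ν - R x ν * R (x + unitVec (fine n M) ν) μ‖ ≤ p)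
    {G : (Tor (fine n M) → Fin d → ℂ) → ℝ} (hG : ∀ W, G W = qform (Kdiv (fine n M) R) (unc W))
    {T : Tor M → (Fin d → Fin n) → Fin n → Fin d → (ℂ →L[ℂ] ℂ)} (hT : ∀ y j t μ, ‖T y j t μ‖ ≤ 1)
    {Λ CP CGar CGar' : ℝ} (hΛ : 0 ≤ Λ) (hCGar : 0 ≤ CGar) (hCGar' : 0 ≤ CGar')
    (hUBc : ∀ φ : Tor M → Fin d → ℂ, ∃ W, QvL n M T W = φ ∧ ScV n M R G W ≤ Λ * nsqV M φ)
    (hPc : ∀ W, qWV n M W ≤ CP * (ScV n M R G W + nsqV M (QvL n M T W)))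
    (hGar : ∀ W, ((n : ℝ) ^ d)⁻¹ * ((n : ℝ) ^ 2 * roughV n M R W) ≤ CGar * ScV n M R G W + CGar' * nsqV M (QvL n M T W)) :
    ∀ (φ : Tor M → Fin d → ℂ) (W : Tor (fine n M) → Fin d → ℂ), QvL n M T W = φ →
      (∀ W₂, QvL n M T W₂ = φ → ScV n M R G W ≤ ScV n M R G W₂) →
      rhoV n M R W ≤ (4 * Λ + 2 * d * ((n : ℝ) ^ 2 * p) * (CGar + CGar') + 5 * (d : ℝ) ^ 2 * ((n : ℝ) ^ 2 * p) ^ 2 * CP)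
        * (ScV n M R G W + nsqV M φ) := by
  intro φ W hW hmin
  have hd : (0 : ℝ) ≤ d := Nat.cast_nonneg d
  have hsc : (0 : ℝ) ≤ (n : ℝ) ^ 4 / (n : ℝ) ^ d := by positivity
  have hG0 : ∀ W, 0 ≤ G W := nonneg_of_qform n M (VariationalVectorLandauTower.Kdiv_posSemidef (fine n M) R) hG
  set S : ℝ := ScV n M R G W with hS
  set Z : ℝ := nsqV M φ with hZ
  set q : ℝ := qWV n M W with hq
  set α : ℝ := (n : ℝ) ^ 2 * p with hα
  have hS0 : 0 ≤ S := ScV_nonneg n M R hG0 W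
  have hZ0 : 0 ≤ Z := nsqV_nonneg M φ
  have hq0 : 0 ≤ q := qWV_nonneg n M W
  have hα0 : 0 ≤ α := by positivity
  have hEL : (n : ℝ) ^ 4 / (n : ℝ) ^ d * ∑ x, ∑ ν, ‖curlAdjCurlV (fine n M) R W x ν + gradDivV (fine n M) R W x ν‖ ^ 2 ≤ Λ * S :=
    physEl_le_of_isMin_div n M hG hT hΛ hUBc hW hmin
  have hGar' : ((n : ℝ) ^ d)⁻¹ * ((n : ℝ) ^ 2 * roughV n M R W) ≤ CGar * S + CGar' * Z := by rw [hS, hZ, ← hW]; exact hGar W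
  have hP' : q ≤ CP * (S + Z) := by rw [hq, hS, hZ, ← hW]; exact hPc W
  have hB := sum_hessv_le_el n M hU hp hP W
  have hrho : rhoV n M R W = (n : ℝ) ^ 4 / (n : ℝ) ^ d * hessV (fine n M) R W := rfl
  have h1 : rhoV n M R W ≤ 4 * (Λ * S) + 2 * d * α * (CGar * S + CGar' * Z) + 5 * (d : ℝ) ^ 2 * α ^ 2 * q := by
    have e : (n : ℝ) ^ 4 / (n : ℝ) ^ d * (4 * ∑ x, ∑ ν, ‖curlAdjCurlV (fine n M) R W x ν + gradDivV (fine n M) R W x ν‖ ^ 2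
        + 2 * p * d * roughV n M R W + 5 * (p ^ 2 * d ^ 2) * nsqV (fine n M) W)
        = 4 * ((n : ℝ) ^ 4 / (n : ℝ) ^ d * ∑ x, ∑ ν, ‖curlAdjCurlV (fine n M) R W x ν + gradDivV (fine n M) R W x ν‖ ^ 2)
          + 2 * d * α * (((n : ℝ) ^ d)⁻¹ * ((n : ℝ) ^ 2 * roughV n M R W)) + 5 * (d : ℝ) ^ 2 * α ^ 2 * q := by
      rw [hα, hq]; unfold qWV; ring
    calc rhoV n M R W ≤ (n : ℝ) ^ 4 / (n : ℝ) ^ d * (4 * ∑ x, ∑ ν, ‖curlAdjCurlV (fine n M) R W x ν + gradDivV (fine n M) R W x ν‖ ^ 2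
          + 2 * p * d * roughV n M R W + 5 * (p ^ 2 * d ^ 2) * nsqV (fine n M) W) := by
            rw [hrho, hessV_eq_sum]; exact mul_le_mul_of_nonneg_left hB hsc
      _ = _ := e
      _ ≤ _ := by
          have h2dα : 0 ≤ 2 * d * α := by positivity
          nlinarith [mul_le_mul_of_nonneg_left hGar' h2dα, hEL]
  have hq' : (5 * (d : ℝ) ^ 2 * α ^ 2) * q ≤ (5 * (d : ℝ) ^ 2 * α ^ 2) * (CP * (S + Z)) := mul_le_mul_of_nonneg_left hP' (by positivity)
  have key : 4 * (Λ * S) + 2 * d * α * (CGar * S + CGar' * Z) + 5 * (d : ℝ) ^ 2 * α ^ 2 * q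
      ≤ (4 * Λ + 2 * d * α * (CGar + CGar') + 5 * (d : ℝ) ^ 2 * α ^ 2 * CP) * (S + Z) := by
    have e2 : (4 * Λ + 2 * d * α * (CGar + CGar') + 5 * (d : ℝ) ^ 2 * α ^ 2 * CP) * (S + Z)
        = 4 * (Λ * S) + 2 * d * α * (CGar * S + CGar' * Z) + 5 * (d : ℝ) ^ 2 * α ^ 2 * (CP * (S + Z))
          + ((4 * Λ + 2 * d * α * CGar) * Z + 2 * d * α * CGar' * S) := by ring
    rw [e2]
    have p1 : 0 ≤ (4 * Λ + 2 * d * α * CGar) * Z := by positivity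
    have p2 : 0 ≤ 2 * d * α * CGar' * S := by positivity
    linarith
  exact h1.trans key

/-- the Feynman–Landau functional IS the divergence form: `landauG 1 R W = qform (Kdiv R) (unc W)`. [folklore] -/
theorem landauG_one_eq_qform_Kdiv (R : Tor (fine n M) → Fin d → (ℂ →L[ℂ] ℂ)) (W : Tor (fine n M) → Fin d → ℂ) :
    landauG (fine n M) 1 R W = qform (Kdiv (fine n M) R) (unc W) := by
  rw [landauG_eq_qform, KLandau, inv_one, Literature.Analysis.Complex.qform_smul, one_mul]

/-- **LEAF V-REG FOR THE FEYNMAN–LANDAU INHABITANT `G = landauG 1 R = divSq R`** (`Gm = KLandau 1 R`, leaf-10-g3's `landauG_eq_qform`): the `hREG k` binder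
of the vector END via the DIRECT route `hREG_rhoV_div` ((REG-G) trivially discharged, `defG_landau_one`) — remaining DISPLAYED binders V-UB (`Λ`), V-P (`C_P`),
(Går) (`CGar`, `CGar′`; leaf-09-g6's `garding_landau` shape); `C_R = 4Λ + 2d(n²p)(CGar + CGar′) + 5d²(n²p)²·C_P`.  HONEST: the Landau functional is the tree's only typed inhabitant of the gauge term; it is NOT offered as
Bałaban's `G` ([B9] (3.26) `D_U R(U) D_U*`); for `landauG δ`, `δ ≠ 1`, (REG-G) is NOT uniform in `n` by this route. [folklore] -/
theorem hREG_rhoV_landau {R : Tor (fine n M) → Fin d → (ℂ →L[ℂ] ℂ)} (hU : ∀ x μ, R x μ ∈ unitary (ℂ →L[ℂ] ℂ)) {p : ℝ} (hp : 0 ≤ p)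
    (hP : ∀ x μ ν, ‖R x μ * R (x + unitVec (fine n M) μ) ν - R x ν * R (x + unitVec (fine n M) ν) μ‖ ≤ p)
    {T : Tor M → (Fin d → Fin n) → Fin n → Fin d → (ℂ →L[ℂ] ℂ)} (hT : ∀ y j t μ, ‖T y j t μ‖ ≤ 1)
    {Λ CP CGar CGar' : ℝ} (hΛ : 0 ≤ Λ) (hCGar : 0 ≤ CGar) (hCGar' : 0 ≤ CGar')
    (hUBc : ∀ φ : Tor M → Fin d → ℂ, ∃ W, QvL n M T W = φ ∧ ScV n M R (landauG (fine n M) 1 R) W ≤ Λ * nsqV M φ)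
    (hPc : ∀ W, qWV n M W ≤ CP * (ScV n M R (landauG (fine n M) 1 R) W + nsqV M (QvL n M T W)))
    (hGar : ∀ W, ((n : ℝ) ^ d)⁻¹ * ((n : ℝ) ^ 2 * roughV n M R W)
      ≤ CGar * ScV n M R (landauG (fine n M) 1 R) W + CGar' * nsqV M (QvL n M T W)) :
    ∀ (φ : Tor M → Fin d → ℂ) (W : Tor (fine n M) → Fin d → ℂ), QvL n M T W = φ →
      (∀ W₂, QvL n M T W₂ = φ → ScV n M R (landauG (fine n M) 1 R) W ≤ ScV n M R (landauG (fine n M) 1 R) W₂) →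
      rhoV n M R W ≤ (4 * Λ + 2 * d * ((n : ℝ) ^ 2 * p) * (CGar + CGar') + 5 * (d : ℝ) ^ 2 * ((n : ℝ) ^ 2 * p) ^ 2 * CP)
        * (ScV n M R (landauG (fine n M) 1 R) W + nsqV M φ) :=
  hREG_rhoV_div n M hU hp hP (landauG_one_eq_qform_Kdiv n M R) hT hΛ hCGar hCGar' hUBc hPc hGar

/-! ## §4 The road's product-line transports `lineT T′ R` (leaf-01-g5 ∕ leaf-09-g6): (Går) and V-P discharged as well — only V-UB displayed -/

/-- **LEAF V-REG FOR THE FEYNMAN–LANDAU INHABITANT ON THE ROAD's PRODUCT-LINE TRANSPORTS `QvL (lineT T′ R)`** (model level, `E = ℂ`): UNITARY site transports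
`T′` and bond transports `R`, the in-block defect class `‖R(x,μ)∘T′(x+e_μ)⋆∘T′(x) − 1‖ ≤ w`, `2d(nw)² ≤ ½` and the plaquette class `40·d·(n²p) ≤ 1` (leaf-01-g5's
`qWV_le_line_poincare` ∕ leaf-09-g6's `garding_landau`, `qWV_le_line_landau` BY NAME discharge (Går) and V-P); the ONLY displayed leaf binder is V-UB (`Λ`):
for every datum `φ` and every minimiser `W` of `ScV n M R (landauG 1 R)` on `{QvL (lineT T′ R) · = φ}`,

  `rhoV n M R W ≤ (4Λ + ½)·(ScV n M R (landauG 1 R) W + nsqV M φ)`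

— k-UNIFORM (`2dα(4 + 32dα) + 5(dα)²·80 ≤ ½` for `dα := d·n²p ≤ 1∕40`).  No NE3, no propagator, no multiplier. [folklore] -/
theorem hREG_rhoV_landau_line {R : Tor (fine n M) → Fin d → (ℂ →L[ℂ] ℂ)} (hU : ∀ x μ, R x μ ∈ unitary (ℂ →L[ℂ] ℂ))
    {T' : Tor (fine n M) → (ℂ →L[ℂ] ℂ)} (hT' : ∀ x, T' x ∈ unitary (ℂ →L[ℂ] ℂ)) {w : ℝ}
    (hw : ∀ (x : Tor (fine n M)) (μ : Fin d), blockOf n M (x + unitVec (fine n M) μ) = blockOf n M x →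
      ‖R x μ * star (T' (x + unitVec (fine n M) μ)) * T' x - 1‖ ≤ w)
    (hsmallw : 2 * (d : ℝ) * ((n : ℝ) * w) ^ 2 ≤ 1 / 2) {p : ℝ} (hp : 0 ≤ p)
    (hP : ∀ x μ ν, ‖R x μ * R (x + unitVec (fine n M) μ) ν - R x ν * R (x + unitVec (fine n M) ν) μ‖ ≤ p)
    (hsmallp : 40 * (d * ((n : ℝ) ^ 2 * p)) ≤ 1) {Λ : ℝ} (hΛ : 0 ≤ Λ)
    (hUBc : ∀ φ : Tor M → Fin d → ℂ, ∃ W, QvL n M (lineT n M T' R) W = φ ∧ ScV n M R (landauG (fine n M) 1 R) W ≤ Λ * nsqV M φ) :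
    ∀ (φ : Tor M → Fin d → ℂ) (W : Tor (fine n M) → Fin d → ℂ), QvL n M (lineT n M T' R) W = φ →
      (∀ W₂, QvL n M (lineT n M T' R) W₂ = φ → ScV n M R (landauG (fine n M) 1 R) W ≤ ScV n M R (landauG (fine n M) 1 R) W₂) →
      rhoV n M R W ≤ (4 * Λ + 1 / 2) * (ScV n M R (landauG (fine n M) 1 R) W + nsqV M φ) := by
  intro φ W hW hmin
  have hd : (0 : ℝ) ≤ d := Nat.cast_nonneg d
  have hR1 : ∀ x μ, ‖R x μ‖ ≤ 1 := fun x μ => norm_le_one_of_mem_unitary (hU x μ)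
  have hT1 : ∀ x, ‖T' x‖ ≤ 1 := fun x => norm_le_one_of_mem_unitary (hT' x)
  have hT : ∀ y j t μ, ‖lineT n M T' R y j t μ‖ ≤ 1 := fun y j t μ => norm_lineT_le_one n M hR1 hT1 y j t μ
  -- (Går) and V-P for the Landau form on the product-line average (leaf-09-g6 ∕ leaf-01-g5)
  have hsmall : 2 * 20 * (d * ((n : ℝ) ^ 2 * p)) ≤ 1 := by linarith
  have hGar := fun W => garding_landau n M hU hp hP one_pos (qWV_le_line_poincare n M hT' hR1 hw hsmallw) hsmall W
  have hPc := fun W => qWV_le_line_landau n M hT' hU hw hsmallw hp hP hsmallp one_pos W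
  set a : ℝ := d * ((n : ℝ) ^ 2 * p) with ha
  have ha0 : 0 ≤ a := by positivity
  have ha1 : a ≤ 1 / 40 := by linarith
  have hCGar : (0 : ℝ) ≤ 2 * (1 + 1) := by norm_num
  have hCGar' : (0 : ℝ) ≤ 2 * (0 + a * 16) := by positivity
  have h := hREG_rhoV_landau n M hU hp hP hT hΛ hCGar hCGar' hUBc hPc hGar φ W hW hmin
  -- the explicit constant is at most `4Λ + ½` in the plaquette class
  have hCP : max (20 * (2 * (1 + (1 : ℝ)))) (16 + 20 * (2 * (0 + a * 16))) ≤ 80 := max_le (by norm_num) (by nlinarith)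
  set CP : ℝ := max (20 * (2 * (1 + (1 : ℝ)))) (16 + 20 * (2 * (0 + a * 16))) with hCPdef
  have hconst : 4 * Λ + 2 * d * ((n : ℝ) ^ 2 * p) * (2 * (1 + 1) + 2 * (0 + a * 16)) + 5 * (d : ℝ) ^ 2 * ((n : ℝ) ^ 2 * p) ^ 2 * CP
      ≤ 4 * Λ + 1 / 2 := by
    have e : 2 * d * ((n : ℝ) ^ 2 * p) * (2 * (1 + 1) + 2 * (0 + a * 16)) + 5 * (d : ℝ) ^ 2 * ((n : ℝ) ^ 2 * p) ^ 2 * CP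
        = 8 * a + 64 * a ^ 2 + 5 * a ^ 2 * CP := by rw [ha]; ring
    have h1 : a ^ 2 ≤ a * (1 / 40) := by nlinarith
    have h2 : a ^ 2 * CP ≤ a ^ 2 * 80 := mul_le_mul_of_nonneg_left hCP (sq_nonneg a)
    nlinarith [e, h1, h2]
  have hS0 : 0 ≤ ScV n M R (landauG (fine n M) 1 R) W + nsqV M φ :=
    add_nonneg (ScV_nonneg n M R (landauG_nonneg zero_le_one R) W) (nsqV_nonneg M φ)
  exact h.trans (mul_le_mul_of_nonneg_right hconst hS0)

end Summit.QuantumFields.BalabanUV.T4Continuum.VariationalVectorRegularityRho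

end
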